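import Summits.Ventures.PercRepro.RankLevelSetTheoremC

/-!
# PercRepro — LOCAL SPARSITY of the `e`-free core at EVERY rank, and the counts it gives (night-1, gen 3)

`proofs/NIGHT-1-C025-induction.md` §14 (Theorem C∞). The core of the `|E|`-induction wrapper (`rls_succ_all`,
`rls_succ_bounded`) is a matroid in which every element `e` admits an `e`-FREE PARTITION of `E ∖ {e}` (two sides, neither
spanning `e`). (C1) «lines have `≤ 3` points» and (C2) «planes have `≤ 7` points» (`RankLevelSetCoreSparse`) are the
ranks `2`, `3` of ONE statement:

* **`ncard_add_one_le_two_pow_of_eRk_le`** — in a loopless finite matroid with `e`-free partitions, every set of rank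
  `≤ k` has at most `2^k − 1` elements (induction on `k`: a set `X ∋ e` of rank `k + 1` is covered by `{e}` and the two
  sides of an `e`-free partition, each of rank `≤ k` inside `X` because neither spans `e`);
* **`ncard_eRk_eq_le_choose_mul`** — hence `#{X ⊆ E : r(X) = q} ≤ C(n, q) · 2^{2^q − 1}` (every rank-`q` set lies in
  the closure of one of its bases, a `q`-subset of `E`, and that closure has `≤ 2^q − 1` points);
* **`ncard_eRk_le_le_sum_choose`** — `#{X ⊆ E : r(X) ≤ q} ≤ Σ_{j < 2^q} C(n, j)` (such sets have `< 2^q` elements);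
* **`choose_le_midCount_of_two_pow_le`** — `C(n, p − 1) ≤ #Y(p, q)` once `2^q ≤ p − 1` (every `(p − 1)`-subset has
  rank `< p`, and rank `> q` because a rank-`≤ q` set has `< 2^q ≤ p − 1` elements).
The first two are the «`C(n, q)` times a constant» counts that the unbounded-corank regimes of Theorem C∞ need;
`hfree` forces looplessness (a loop lies in every closure), so `hL` is stated separately only for convenience.
Axioms: standard.
-/

open scoped Matroid

namespace PercRepro

namespace ThmN

open Set

variable {α : Type}

/-- **Local sparsity at every rank**: in a finite matroid without loops in which every element `e` admits an
`e`-free partition of `E ∖ {e}`, a set of rank `≤ k` has at most `2^k − 1` elements. -/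
theorem ncard_add_one_le_two_pow_of_eRk_le (M : Matroid α) [M.Finite]
    (hL : ∀ e ∈ M.E, ¬ M.IsLoop e)
    (hfree : ∀ e ∈ M.E, ∃ A ⊆ M.E \ {e}, e ∉ M.closure A ∧ e ∉ M.closure ((M.E \ {e}) \ A))
    (k : ℕ) : ∀ X ⊆ M.E, M.eRk X ≤ k → X.ncard + 1 ≤ 2 ^ k := by
  induction k with
  | zero =>
    intro X hX hr
    have h0 : M.eRk X = 0 := by simpa using hr
    rw [Matroid.eRk_eq_zero_iff hX] at h0
    have hXe : X = ∅ := by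
      rw [Set.eq_empty_iff_forall_notMem]
      intro e he
      exact hL e (hX he) (Matroid.isLoop_iff.2 (h0 he))
    rw [hXe, Set.ncard_empty]
    norm_num
  | succ k ih =>
    intro X hX hr
    rcases le_or_gt (M.eRk X) k with hk | hk
    · calc X.ncard + 1 ≤ 2 ^ k := ih X hX hk
        _ ≤ 2 ^ (k + 1) := Nat.pow_le_pow_right (by norm_num) (by omega)
    · obtain ⟨e, he⟩ : X.Nonempty := by
        rw [Set.nonempty_iff_ne_empty]
        rintro rfl
        simp at hk
      have heE : e ∈ M.E := hX he
      obtain ⟨A, hA, heA, heB⟩ := hfree e heE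
      have hXfin : X.Finite := M.ground_finite.subset hX
      -- the two sides of the partition, inside `X`
      have heA₁ : e ∉ M.closure (A ∩ X) := fun h => heA (M.closure_subset_closure Set.inter_subset_left h)
      have heA₂ : e ∉ M.closure (((M.E \ {e}) \ A) ∩ X) :=
        fun h => heB (M.closure_subset_closure Set.inter_subset_left h)
      have hside : ∀ Y ⊆ X, e ∉ M.closure Y → M.eRk Y ≤ k := by
        intro Y hY heY
        have h1 : M.eRk (insert e Y) = M.eRk Y + 1 := Matroid.eRk_insert_eq_add_one ⟨heE, heY⟩
        have h2 : M.eRk (insert e Y) ≤ M.eRk X := M.eRk_mono (Set.insert_subset he hY)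
        have h3 : M.eRk Y + 1 ≤ (k : ℕ∞) + 1 := by
          rw [← h1]
          refine h2.trans ?_
          have : ((k + 1 : ℕ) : ℕ∞) = (k : ℕ∞) + 1 := by push_cast; rfl
          rw [← this]; exact hr
        exact (ENat.add_le_add_iff_right (by simp)).1 h3
      have hc₁ := ih (A ∩ X) (Set.inter_subset_right.trans hX) (hside _ Set.inter_subset_right heA₁)
      have hc₂ := ih (((M.E \ {e}) \ A) ∩ X) (Set.inter_subset_right.trans hX)
        (hside _ Set.inter_subset_right heA₂)
      have hcover : X ⊆ insert e ((A ∩ X) ∪ (((M.E \ {e}) \ A) ∩ X)) := by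
        intro x hx
        by_cases hxe : x = e
        · rw [hxe]; exact Set.mem_insert e _
        · refine Set.mem_insert_of_mem e ?_
          by_cases hxA : x ∈ A
          · exact Or.inl ⟨hxA, hx⟩
          · exact Or.inr ⟨⟨⟨hX hx, hxe⟩, hxA⟩, hx⟩
      have hfin₁ : (A ∩ X).Finite := hXfin.subset Set.inter_subset_right
      have hfin₂ : (((M.E \ {e}) \ A) ∩ X).Finite := hXfin.subset Set.inter_subset_right
      have h4 : X.ncard ≤ (insert e ((A ∩ X) ∪ (((M.E \ {e}) \ A) ∩ X))).ncard :=
        Set.ncard_le_ncard hcover ((hfin₁.union hfin₂).insert e)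
      have h5 := Set.ncard_insert_le e ((A ∩ X) ∪ (((M.E \ {e}) \ A) ∩ X))
      have h6 := Set.ncard_union_le (A ∩ X) (((M.E \ {e}) \ A) ∩ X)
      have h7 : 2 ^ (k + 1) = 2 ^ k + 2 ^ k := by ring
      omega

/-- An `e`-free partition for every element forces looplessness (a loop lies in every closure). -/
theorem not_isLoop_of_free (M : Matroid α)
    (hfree : ∀ e ∈ M.E, ∃ A ⊆ M.E \ {e}, e ∉ M.closure A ∧ e ∉ M.closure ((M.E \ {e}) \ A)) :
    ∀ e ∈ M.E, ¬ M.IsLoop e := by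
  intro e he hloop
  obtain ⟨A, -, heA, -⟩ := hfree e he
  exact heA (M.closure_subset_closure (Set.empty_subset A) (by
    rw [Matroid.isLoop_iff] at hloop
    exact hloop))

/-- **The rank-`q` sets of the `e`-free core number at most `C(n, q) · 2^{2^q − 1}`**: every rank-`q` set lies in the
closure of one of its bases (a `q`-subset of `E`), and that closure has at most `2^q − 1` elements. -/
theorem ncard_eRk_eq_le_choose_mul (M : Matroid α) [M.Finite]
    (hfree : ∀ e ∈ M.E, ∃ A ⊆ M.E \ {e}, e ∉ M.closure A ∧ e ∉ M.closure ((M.E \ {e}) \ A)) (q : ℕ) :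
    {X : Set α | X ⊆ M.E ∧ M.eRk X = q}.ncard ≤ M.ground_finite.toFinset.card.choose q * 2 ^ (2 ^ q - 1) := by
  classical
  have hL := not_isLoop_of_free M hfree
  set Ef := M.ground_finite.toFinset with hEf
  have hE : (Ef : Set α) = M.E := Set.Finite.coe_toFinset _
  set S := {X : Set α | X ⊆ M.E ∧ M.eRk X = q} with hS
  have hclfin : ∀ s : Finset α, (M.closure (s : Set α)).Finite :=
    fun s => M.ground_finite.subset (M.closure_subset_ground _)
  set Tf : Finset (Finset α × Set α) := (Ef.powersetCard q).biUnion (fun s =>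
    ((hclfin s).toFinset.powerset.image (fun t : Finset α => (t : Set α))).image (fun Z => (s, Z))) with hTf
  -- every rank-`q` set `X` lands in `Tf`, over the finset of one of its bases
  have hex : ∀ X ∈ S, ∃ s : Finset α, (s, X) ∈ Tf := by
    intro X hX
    obtain ⟨I, hI⟩ := M.exists_isBasis X hX.1
    have hIfin : I.Finite := M.ground_finite.subset (hI.subset.trans hX.1)
    have hIcard : I.ncard = q := by
      have h := hI.encard_eq_eRk
      rw [hX.2, ← hIfin.cast_ncard_eq] at h
      exact_mod_cast h
    refine ⟨hIfin.toFinset, ?_⟩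
    rw [hTf, Finset.mem_biUnion]
    refine ⟨hIfin.toFinset, ?_, ?_⟩
    · rw [Finset.mem_powersetCard]
      refine ⟨?_, ?_⟩
      · intro x hx
        rw [Set.Finite.mem_toFinset] at hx
        rw [hEf, Set.Finite.mem_toFinset]
        exact hX.1 (hI.subset hx)
      · rw [← Set.ncard_eq_toFinset_card I hIfin]; exact hIcard
    · rw [Finset.mem_image]
      refine ⟨X, ?_, rfl⟩
      apply Matroid.mem_powersetSets
      rw [Set.Finite.coe_toFinset]
      exact hI.subset_closure
  -- the injection `X ↦ (s_X, X)`
  let g : Set α → Finset α × Set α := fun X =>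
    if h : X ∈ S then (Classical.choose (hex X h), X) else (∅, X)
  have hgmaps : ∀ X ∈ S, g X ∈ (Tf : Set (Finset α × Set α)) := by
    intro X hX
    simp only [g, dif_pos hX]
    exact Classical.choose_spec (hex X hX)
  have hginj : Set.InjOn g S := by
    intro X hX Y hY hXY
    simp only [g, dif_pos hX, dif_pos hY, Prod.mk.injEq] at hXY
    exact hXY.2
  have hS : S.ncard ≤ Tf.card := by
    rw [← Set.ncard_coe_finset]
    exact Set.ncard_le_ncard_of_injOn g hgmaps hginj (Tf.finite_toSet)
  -- the size of `Tf`: each closure has `≤ 2^q − 1` points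
  have hTfcard : Tf.card ≤ Ef.card.choose q * 2 ^ (2 ^ q - 1) := by
    calc Tf.card ≤ ∑ s ∈ Ef.powersetCard q,
          (((hclfin s).toFinset.powerset.image (fun t : Finset α => (t : Set α))).image (fun Z => (s, Z))).card :=
          Finset.card_biUnion_le
      _ ≤ ∑ s ∈ Ef.powersetCard q, 2 ^ (2 ^ q - 1) := by
          apply Finset.sum_le_sum
          intro s hs
          rw [Finset.mem_powersetCard] at hs
          calc (((hclfin s).toFinset.powerset.image (fun t : Finset α => (t : Set α))).image
                (fun Z => (s, Z))).card
              ≤ ((hclfin s).toFinset.powerset.image (fun t : Finset α => (t : Set α))).card :=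
                Finset.card_image_le
            _ ≤ 2 ^ (M.closure (s : Set α)).ncard := Matroid.card_powersetSets_le (hclfin s)
            _ ≤ 2 ^ (2 ^ q - 1) := by
                apply Nat.pow_le_pow_right (by norm_num)
                have hsE : (s : Set α) ⊆ M.E := by rw [← hE]; exact Finset.coe_subset.2 hs.1
                have hr : M.eRk (M.closure (s : Set α)) ≤ q := by
                  rw [M.eRk_closure_eq]
                  calc M.eRk (s : Set α) ≤ (s : Set α).encard := M.eRk_le_encard _
                    _ = q := by rw [Set.encard_coe_eq_coe_finsetCard, hs.2]
                have := ncard_add_one_le_two_pow_of_eRk_le M hL hfree q (M.closure (s : Set α))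
                  (M.closure_subset_ground _) hr
                omega
      _ = Ef.card.choose q * 2 ^ (2 ^ q - 1) := by
          rw [Finset.sum_const, smul_eq_mul, Finset.card_powersetCard]
  exact hS.trans hTfcard

/-- **The sets of rank `≤ q` of the `e`-free core number at most `Σ_{j < 2^q} C(n, j)`**: each has `< 2^q` elements. -/
theorem ncard_eRk_le_le_sum_choose (M : Matroid α) [M.Finite]
    (hfree : ∀ e ∈ M.E, ∃ A ⊆ M.E \ {e}, e ∉ M.closure A ∧ e ∉ M.closure ((M.E \ {e}) \ A)) (q : ℕ) :
    {X : Set α | X ⊆ M.E ∧ M.eRk X ≤ q}.ncard ≤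
      ∑ j ∈ Finset.range (2 ^ q - 1 + 1), M.ground_finite.toFinset.card.choose j := by
  have hL := not_isLoop_of_free M hfree
  have hE : (M.ground_finite.toFinset : Set α) = M.E := Set.Finite.coe_toFinset _
  have hsub : {X : Set α | X ⊆ M.E ∧ M.eRk X ≤ q} ⊆
      {X : Set α | X ⊆ (M.ground_finite.toFinset : Set α) ∧ X.ncard ≤ 2 ^ q - 1} := by
    intro X hX
    refine ⟨by rw [hE]; exact hX.1, ?_⟩
    have := ncard_add_one_le_two_pow_of_eRk_le M hL hfree q X hX.1 hX.2
    omega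
  calc {X : Set α | X ⊆ M.E ∧ M.eRk X ≤ q}.ncard
      ≤ {X : Set α | X ⊆ (M.ground_finite.toFinset : Set α) ∧ X.ncard ≤ 2 ^ q - 1}.ncard :=
        Set.ncard_le_ncard hsub ((M.ground_finite.toFinset.finite_toSet.finite_subsets).subset
          (fun X hX => hX.1))
    _ ≤ _ := ncard_subsets_ncard_le _ _

/-- **`C(n, p − 1) ≤ #Y(p, q)` on the `e`-free core once `2^q ≤ p − 1`**: every `(p − 1)`-subset of `E` has rank
`< p`, and rank `> q` since a set of rank `≤ q` has `< 2^q` elements. -/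
theorem choose_le_midCount_of_two_pow_le (M : Matroid α) [M.Finite]
    (hfree : ∀ e ∈ M.E, ∃ A ⊆ M.E \ {e}, e ∉ M.closure A ∧ e ∉ M.closure ((M.E \ {e}) \ A))
    {p q : ℕ} (hp : 2 ^ q ≤ p - 1) (hp1 : 1 ≤ p) :
    M.ground_finite.toFinset.card.choose (p - 1) ≤ Matroid.midCount M p q := by
  have hL := not_isLoop_of_free M hfree
  have hE : (M.ground_finite.toFinset : Set α) = M.E := Set.Finite.coe_toFinset _
  rw [← ncard_subsets_ncard_eq M.ground_finite.toFinset (p - 1)]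
  unfold Matroid.midCount
  apply Set.ncard_le_ncard
  · intro X hX
    have hXE : X ⊆ M.E := by rw [← hE]; exact hX.1
    have hXfin : X.Finite := M.ground_finite.subset hXE
    refine ⟨hXE, ?_, ?_⟩
    · by_contra hle
      push Not at hle
      have := ncard_add_one_le_two_pow_of_eRk_le M hL hfree q X hXE hle
      have hc := hX.2
      omega
    · calc M.eRk X ≤ X.encard := M.eRk_le_encard X
        _ = ((p - 1 : ℕ) : ℕ∞) := by rw [← hXfin.cast_ncard_eq, hX.2]
        _ < (p : ℕ∞) := by exact_mod_cast (show p - 1 < p by omega)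
  · exact M.ground_finite.finite_subsets.subset (fun X hX => hX.1)

end ThmN

end PercRepro
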